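import Literature.Geometry.Riemannian.FourShrinkerCurvatureBoundedOf
import Literature.Geometry.Lorentzian.CoordShrinkerRmNormSqDrift
import HarnessLib

/-!
# Munteanu–Wang 2015, Thm. 1.4 (second half): `|∇Rm|` is bounded on a complete four-dimensional
# gradient shrinker with bounded scalar curvature — the assembly, modulo registered inputs

Continuation of `FourShrinkerCurvatureBoundedOf.lean`. **Theorem** (O. Munteanu, J. Wang, *Geometry of
shrinking Ricci solitons*, Compositio Math. 151 (2015), Thm. 1.4, p. 6: "`sup_M (|Rm| + |∇Rm|) ≤ C`").
This file ASSEMBLES the bound for `|∇Rm|²_g`, i.e. `curvDerivNormSq (𝓡 4) (fun _ ↦ g) 1 0`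
(`CurvatureDerivativeNormSq.lean`: the invariant `|∇^1 Rm|²`, chart independent, smooth), on a complete
connected four-manifold carrying a normalised gradient shrinker `Ric + Hess f = ½ g`, `R + |∇f|² = f`,
`R ≤ A`:

* `curvDerivNormSq_one_eq_chart` — `|∇Rm|²` read in the chart at `x₀` is the coordinate
  `tnormSq G (finBasis) (tcov G (finBasis) (rm4 G (finBasis)))` of the chart components
  (`curvDerivNormSq_eq_chart`, `curvD 1 = (∇ rm4) ∘ idxEquiv`, `tnormSq_treindex`);
* `curvDerivNormSq_one_bounded_of` — **`|∇Rm|²_g ≤ C`**, from the `Rm` bound (`curvNormSq_bounded_of`,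
  hypotheses `hS5`, `hS9`, `hS11`), the `∇Rm`-equation of MW15 (u1) with its Kato inequality (HYPOTHESIS
  `hS13` = registered stub `helper_mwCovRmNormSqDriftGen`), the bridge from `tnormSq … (tcov … rm4 …)` to
  the frame sums of `CoordShrinkerRmNormSqDrift.lean` (HYPOTHESIS `hS13b` = `helper_mwCovRmNormSqBridgeGen`),
  the pointwise drift inequality for `w = √(|∇Rm|²+1) + |Rm|²`, `Δ_f w ≥ ½w² − K` (HYPOTHESIS `hS14` =
  `helper_mwCovRmDriftChartGen`), transported at every point of `M` through the chart at the point, and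
  the localised maximum principle `hS9` with threshold `r₀ = 0`.

The unconditional theorem follows by `exact` once the three wave-3 stubs land (sibling file
`FourShrinkerCovariantCurvatureBounded.lean`). Everything is proved; no definition and no statement of
`Prop` type is introduced.

## References

* O. Munteanu, J. Wang, *Geometry of shrinking Ricci solitons*, Compositio Math. 151 (2015)
  2273–2300 = arXiv:1410.3813, Thm. 1.4 and its proof (p. 6), Prop. 2.2 / (u1) (p. 7). READ.
  [MunteanuWang2015]
* P. Topping, *Lectures on the Ricci flow*, LMS Lecture Note Series 325, CUP 2006, §3.3 (Thm. 3.3.1).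
  [Topping2006]
-/

noncomputable section

set_option maxSynthPendingDepth 3

open Set Filter Module Metric
open scoped Manifold ContDiff Topology NNReal ENNReal

namespace Literature.Geometry.Riemannian

open Lorentzian Lorentzian.PseudoRiemannianMetric

namespace FourShrinker

variable {M : Type} [TopologicalSpace M] [T2Space M] [SecondCountableTopology M]
  [ChartedSpace (EuclideanSpace ℝ (Fin 4)) M] [IsManifold (𝓡 4) ∞ M] [ConnectedSpace M]
  [T3Space M] [MeasurableSpace M] [BorelSpace M]
  (g : PseudoRiemannianMetric (𝓡 4) ∞ (EuclideanSpace ℝ (Fin 4)) (TangentSpace (𝓡 4) : M → Type _))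
  [g.HasLeviCivita] (f : M → ℝ)

omit [T2Space M] [SecondCountableTopology M] [ConnectedSpace M] [T3Space M] [MeasurableSpace M]
  [BorelSpace M] [g.HasLeviCivita] in
/-- **`|∇Rm|²` read in the chart at `x₀`**: for `z` in the source of the chart at `x₀`,
`U_1(z) = |∇ rm4|²_G (extChartAt x₀ z)` with `G` the chart components at `x₀` and the standard
basis (`curvDerivNormSq_eq_chart`, `curvD 1 = (∇ rm4) ∘ idxEquiv`, `tnormSq_treindex`).
[cite: Topping2006, §3.3, Thm. 3.3.1] -/
theorem curvDerivNormSq_one_eq_chart (hg : g.IsRiemannian) (x₀ : M) {z : M}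
    (hz : z ∈ (extChartAt (𝓡 4) x₀).source) :
    curvDerivNormSq (𝓡 4) (fun _ ↦ g) 1 0 z =
      MetricCoord.tnormSq (chartRep (𝓡 4) (fun _ ↦ g) x₀ 0) (finBasis ℝ (EuclideanSpace ℝ (Fin 4)))
        (MetricCoord.tcov (chartRep (𝓡 4) (fun _ ↦ g) x₀ 0) (finBasis ℝ (EuclideanSpace ℝ (Fin 4)))
          (MetricCoord.rm4 (chartRep (𝓡 4) (fun _ ↦ g) x₀ 0) (finBasis ℝ (EuclideanSpace ℝ (Fin 4)))))
        (extChartAt (𝓡 4) x₀ z) := by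
  rw [curvDerivNormSq_eq_chart (g := fun _ ↦ g) (t := 0) hg hz 1, MetricCoord.curvD_succ,
    MetricCoord.tnormSq_treindex, MetricCoord.curvD_zero]

set_option maxHeartbeats 400000 in
/-- **Munteanu–Wang 2015, Thm. 1.4 (second half: boundedness of `|∇Rm|`)**, modulo the registered
inputs `helper_mwRmNormSqDrift` (`hS5`), `helper_mwShrinkerMaxPrinciple` (`hS9`), `helper_mwRmDriftChart`
(`hS11`) — through `curvNormSq_bounded_of` —, and `helper_mwCovRmNormSqDriftGen` (`hS13`: the
`∇Rm`-equation + Kato), `helper_mwCovRmNormSqBridgeGen` (`hS13b`), `helper_mwCovRmDriftChartGen` (`hS14`: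
the pointwise drift inequality for `w = √(|∇Rm|²+1) + |Rm|²`): on a complete connected four-dimensional
gradient shrinking Ricci soliton `Ric + Hess f = ½ g`, `R + |∇f|² = f`, with `R ≤ A`, the square norm
`|∇Rm|²_g` (`curvDerivNormSq … 1`) is bounded. [cite: MunteanuWang2015, Thm. 1.4] -/
theorem curvDerivNormSq_one_bounded_of (hg : g.IsRiemannian)
    (hS5 : ∃ C : ℝ, ∀ {E : Type} [NormedAddCommGroup E] [NormedSpace ℝ E] [FiniteDimensional ℝ E] [CompleteSpace E] (G : E → E →L[ℝ] E →L[ℝ] ℝ) (V : Set E) (x : E) (f : E → ℝ), MetricCoord.IsMetricOn G V → x ∈ V → Module.finrank ℝ E = 4 → (∀ y ∈ V, ∀ v : E, v ≠ 0 → 0 < G y v v) → ContDiffOn ℝ ∞ f V → (∀ y ∈ V, ∀ v w : E, MetricCoord.ricAt G y v w + MetricCoord.hessAt G f y v w = (1 / 2 : ℝ) * G y v w) → ∃ N : ℝ, 0 ≤ N ∧ 2 * N - C * (Real.sqrt (MetricCoord.rmNormSqAt G x) + 1) * MetricCoord.rmNormSqAt G x ≤ MetricCoord.lapAt G (MetricCoord.rmNormSqAt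 G) x - fderiv ℝ (MetricCoord.rmNormSqAt G) x (MetricCoord.sharpAt G x (fderiv ℝ f x)) ∧ MetricCoord.gradSqAt G (MetricCoord.rmNormSqAt G) x ≤ 4 * MetricCoord.rmNormSqAt G x * N)
    (hS9 : ∀ (n : ℕ) (M : Type) [TopologicalSpace M] [T2Space M] [SecondCountableTopology M] [ChartedSpace (EuclideanSpace ℝ (Fin n)) M] [IsManifold (𝓡 n) ∞ M] [ConnectedSpace M] [T3Space M] (g : PseudoRiemannianMetric (𝓡 n) ∞ (EuclideanSpace ℝ (Fin n)) (TangentSpace (𝓡 n) : M → Type _)) [g.HasLeviCivita] (f u : M → ℝ) (hg : g.IsRiemannian) (α β r₀ : ℝ), 0 < α → (∀ c : ℝ, IsCompact {y : M | f y ≤ c}) → ContMDiff (𝓡 n) 𝓘(ℝ, ℝ) ∞ f → ContMDiff (𝓡 n) 𝓘(ℝ, ℝ) ∞ u → (∀ (x : M) (X Y : TangentSpace (𝓡 n) x), g.ricci x X Y + g.hessian f x X Y = (1 / 2 : ℝ) * g.val x X Y) → (∀ x : M, g.scalarCurvature x + g.gradSq f x = f x) → (∀ x : M, 0 ≤ g.scalarCurvature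 x) → (∀ x : M, r₀ ≤ f x → α * u x ^ 2 - β ≤ g.dalembertian u x - g.innerDual x (mvfderiv (𝓡 n) f x).toLinearMap (mvfderiv (𝓡 n) u x).toLinearMap) → ∃ C : ℝ, ∀ x : M, u x ≤ C)
    (hS11 : ∀ {E : Type} [NormedAddCommGroup E] [NormedSpace ℝ E] [FiniteDimensional ℝ E] [CompleteSpace E] (G : E → E →L[ℝ] E →L[ℝ] ℝ) (V : Set E) (x : E) (f : E → ℝ) (b : Module.Basis (Fin 4) ℝ E) (C₅ B : ℝ), MetricCoord.IsMetricOn G V → x ∈ V → (∀ v : E, v ≠ 0 → 0 < G x v v) → ContDiffOn ℝ ∞ f V → (∀ y ∈ V, ∀ v w : E, MetricCoord.ricAt G y v w + MetricCoord.hessAt G f y v w = (1 / 2 : ℝ) * G y v w) → 0 ≤ C₅ → 0 ≤ B → MetricCoord.normSqAt G x (MetricCoord.ricAt G x) ≤ B → 32 * (C₅ + 1) ≤ MetricCoord.gradSqAt G f x → MetricCoord.gradSqAt G f x * MetricCoord.rmNormSqAt G x ≤ 16 * MetricCoord.gradSqAt G f x * MetricCoord.normSqAt G x (MetricCoord.ricAt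 G x) + 64 * ∑ k, ∑ l, MetricCoord.ginv G b x k l * MetricCoord.pairAt G x (MetricCoord.cov₂At G (MetricCoord.ricAt G) x (b k)) (MetricCoord.cov₂At G (MetricCoord.ricAt G) x (b l)) → 2 * (∑ k, ∑ l, MetricCoord.ginv G b x k l * MetricCoord.pairAt G x (MetricCoord.cov₂At G (MetricCoord.ricAt G) x (b k)) (MetricCoord.cov₂At G (MetricCoord.ricAt G) x (b l))) + 2 * MetricCoord.normSqAt G x (MetricCoord.ricAt G x) - 4 * Real.sqrt (MetricCoord.rmNormSqAt G x) * MetricCoord.normSqAt G x (MetricCoord.ricAt G x) ≤ MetricCoord.lapAt G (fun y ↦ MetricCoord.normSqAt G y (MetricCoord.ricAt G y)) x - fderiv ℝ (fun y ↦ MetricCoord.normSqAt G y (MetricCoord.ricAt G y)) x (MetricCoord.sharpAt G x (fderiv ℝ f x)) → (∃ N : ℝ, 0 ≤ N ∧ 2 * N - C₅ * (Real.sqrt (MetricCoord.rmNormSqAt G x) + 1) * MetricCoord.rmNormSqAt G x ≤ MetricCoord.lapAt G (MetricCoord.rmNormSqAt G) x - fderiv ℝ (MetricCoord.rmNormSqAt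 G) x (MetricCoord.sharpAt G x (fderiv ℝ f x)) ∧ MetricCoord.gradSqAt G (MetricCoord.rmNormSqAt G) x ≤ 4 * MetricCoord.rmNormSqAt G x * N) → 1 / 4 * ((MetricCoord.rmNormSqAt G x + 1) ^ ((1 / 2 : ℝ)) + MetricCoord.normSqAt G x (MetricCoord.ricAt G x)) ^ 2 - ((C₅ + 1) * (16 * B + 1) + 9 * B ^ 2) ≤ MetricCoord.lapAt G (fun y ↦ (MetricCoord.rmNormSqAt G y + 1) ^ ((1 / 2 : ℝ)) + MetricCoord.normSqAt G y (MetricCoord.ricAt G y)) x - fderiv ℝ (fun y ↦ (MetricCoord.rmNormSqAt G y + 1) ^ ((1 / 2 : ℝ)) + MetricCoord.normSqAt G y (MetricCoord.ricAt G y)) x (MetricCoord.sharpAt G x (fderiv ℝ f x)))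
    (hS13 : ∃ C : ℝ, ∀ {E : Type} [NormedAddCommGroup E] [NormedSpace ℝ E] [FiniteDimensional ℝ E] [CompleteSpace E] (G : E → E →L[ℝ] E →L[ℝ] ℝ) (V : Set E) (x : E) (f : E → ℝ) {ι : Type} [Fintype ι] [DecidableEq ι] (b : Module.Basis ι ℝ E), MetricCoord.IsMetricOn G V → x ∈ V → Module.finrank ℝ E = 4 → (∀ v : E, v ≠ 0 → 0 < G x v v) → ContDiffOn ℝ ∞ f V → (∀ y ∈ V, ∀ v w : E, MetricCoord.ricAt G y v w + MetricCoord.hessAt G f y v w = (1 / 2 : ℝ) * G y v w) → 2 * MetricCoord.tnormSq G b (MetricCoord.tcov G b (MetricCoord.tcov G b (MetricCoord.rm4 G b))) x + 3 * MetricCoord.tnormSq G b (MetricCoord.tcov G b (MetricCoord.rm4 G b)) x - C * (Real.sqrt (MetricCoord.rmNormSqAt G x) + 1) * MetricCoord.tnormSq G b (MetricCoord.tcov G b (MetricCoord.rm4 G b)) x ≤ MetricCoord.lapAt G (MetricCoord.tnormSq G b (MetricCoord.tcov G b (MetricCoord.rm4 G b))) x - fderiv ℝ (MetricCoord.tnormSq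 G b (MetricCoord.tcov G b (MetricCoord.rm4 G b))) x (MetricCoord.sharpAt G x (fderiv ℝ f x)) ∧ MetricCoord.gradSqAt G (MetricCoord.tnormSq G b (MetricCoord.tcov G b (MetricCoord.rm4 G b))) x ≤ 4 * MetricCoord.tnormSq G b (MetricCoord.tcov G b (MetricCoord.rm4 G b)) x * MetricCoord.tnormSq G b (MetricCoord.tcov G b (MetricCoord.tcov G b (MetricCoord.rm4 G b))) x ∧ 0 ≤ MetricCoord.tnormSq G b (MetricCoord.tcov G b (MetricCoord.rm4 G b)) x ∧ 0 ≤ MetricCoord.tnormSq G b (MetricCoord.tcov G b (MetricCoord.tcov G b (MetricCoord.rm4 G b))) x)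
    (hS13b : ∀ {E : Type} [NormedAddCommGroup E] [NormedSpace ℝ E] [FiniteDimensional ℝ E] [CompleteSpace E] (G : E → E →L[ℝ] E →L[ℝ] ℝ) (V : Set E) (x : E) {ι : Type} [Fintype ι] [DecidableEq ι] (b : Module.Basis ι ℝ E) (e : Module.Basis (Fin 4) ℝ E), MetricCoord.IsMetricOn G V → x ∈ V → Module.finrank ℝ E = 4 → (∀ i j, G x (e i) (e j) = if i = j then 1 else 0) → MetricCoord.tnormSq G b (MetricCoord.tcov G b (MetricCoord.rm4 G b)) x = ∑ k, ∑ a, ∑ c, ∑ i, ∑ j, (G x (MetricCoord.covRiemAt G x (e k) (e a) (e c) (e i)) (e j)) ^ 2 ∧ MetricCoord.tnormSq G b (MetricCoord.rm4 G b) x = MetricCoord.rmNormSqAt G x)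
    (hS14 : ∀ {E : Type} [NormedAddCommGroup E] [NormedSpace ℝ E] [FiniteDimensional ℝ E] [CompleteSpace E] (G : E → E →L[ℝ] E →L[ℝ] ℝ) (V : Set E) (x : E) (f : E → ℝ) {ι : Type} [Fintype ι] [DecidableEq ι] (b : Module.Basis ι ℝ E) (C₁ C₅ K₀ : ℝ), MetricCoord.IsMetricOn G V → x ∈ V → (∀ v : E, v ≠ 0 → 0 < G x v v) → ContDiffOn ℝ ∞ f V → (∀ y ∈ V, ∀ v w : E, MetricCoord.ricAt G y v w + MetricCoord.hessAt G f y v w = (1 / 2 : ℝ) * G y v w) → 0 ≤ C₁ → 0 ≤ C₅ → 0 ≤ K₀ → MetricCoord.rmNormSqAt G x ≤ K₀ → 2 * MetricCoord.tnormSq G b (MetricCoord.tcov G b (MetricCoord.rm4 G b)) x - C₅ * (Real.sqrt (MetricCoord.rmNormSqAt G x) + 1) * MetricCoord.rmNormSqAt G x ≤ MetricCoord.lapAt G (MetricCoord.rmNormSqAt G) x - fderiv ℝ (MetricCoord.rmNormSqAt G) x (MetricCoord.sharpAt G x (fderiv ℝ f x)) → (2 * MetricCoord.tnormSq G b (MetricCoord.tcov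 G b (MetricCoord.tcov G b (MetricCoord.rm4 G b))) x + 3 * MetricCoord.tnormSq G b (MetricCoord.tcov G b (MetricCoord.rm4 G b)) x - C₁ * (Real.sqrt (MetricCoord.rmNormSqAt G x) + 1) * MetricCoord.tnormSq G b (MetricCoord.tcov G b (MetricCoord.rm4 G b)) x ≤ MetricCoord.lapAt G (MetricCoord.tnormSq G b (MetricCoord.tcov G b (MetricCoord.rm4 G b))) x - fderiv ℝ (MetricCoord.tnormSq G b (MetricCoord.tcov G b (MetricCoord.rm4 G b))) x (MetricCoord.sharpAt G x (fderiv ℝ f x)) ∧ MetricCoord.gradSqAt G (MetricCoord.tnormSq G b (MetricCoord.tcov G b (MetricCoord.rm4 G b))) x ≤ 4 * MetricCoord.tnormSq G b (MetricCoord.tcov G b (MetricCoord.rm4 G b)) x * MetricCoord.tnormSq G b (MetricCoord.tcov G b (MetricCoord.tcov G b (MetricCoord.rm4 G b))) x ∧ 0 ≤ MetricCoord.tnormSq G b (MetricCoord.tcov G b (MetricCoord.rm4 G b)) x ∧ 0 ≤ MetricCoord.tnormSq G b (MetricCoord.tcov G b (MetricCoord.tcov G b (MetricCoord.rm4 G b)))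 x) → 1 / 2 * ((MetricCoord.tnormSq G b (MetricCoord.tcov G b (MetricCoord.rm4 G b)) x + 1) ^ ((1 / 2 : ℝ)) + MetricCoord.rmNormSqAt G x) ^ 2 - (2 + 2 * K₀ ^ 2 + C₅ * (Real.sqrt K₀ + 1) * K₀ + C₁ ^ 2 * (Real.sqrt K₀ + 1) ^ 2) ≤ MetricCoord.lapAt G (fun y ↦ (MetricCoord.tnormSq G b (MetricCoord.tcov G b (MetricCoord.rm4 G b)) y + 1) ^ ((1 / 2 : ℝ)) + MetricCoord.rmNormSqAt G y) x - fderiv ℝ (fun y ↦ (MetricCoord.tnormSq G b (MetricCoord.tcov G b (MetricCoord.rm4 G b)) y + 1) ^ ((1 / 2 : ℝ)) + MetricCoord.rmNormSqAt G y) x (MetricCoord.sharpAt G x (fderiv ℝ f x)))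
    (hc : ∀ (x : M) (r : ℝ≥0), IsCompact {y : M | g.edist hg x y ≤ r})
    (hf : ContMDiff (𝓡 4) 𝓘(ℝ, ℝ) ∞ f)
    (hsol : ∀ (x : M) (X Y : TangentSpace (𝓡 4) x),
      g.ricci x X Y + g.hessian f x X Y = (1 / 2 : ℝ) * g.val x X Y)
    (hnorm : ∀ x : M, g.scalarCurvature x + g.gradSq f x = f x)
    {A : ℝ} (hA : ∀ x : M, g.scalarCurvature x ≤ A) :
    ∃ C : ℝ, ∀ x : M, curvDerivNormSq (𝓡 4) (fun _ ↦ g) 1 0 x ≤ C := by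
  classical
  have hR0 : ∀ y : M, 0 ≤ g.scalarCurvature y :=
    shrinkerScalarCurvature_nonneg_holds 4 M g f hg hc hf hsol hnorm
  -- the `Rm` bound
  obtain ⟨K', hK'⟩ := curvNormSq_bounded_of g f hg hS5 hS9 hS11 hc hf hsol hnorm hA
  set K₀ : ℝ := max K' 0 with hK₀def
  have hK₀0 : 0 ≤ K₀ := le_max_right _ _
  have hK₀ : ∀ y, g.curvNormSqWith g.leviCivita y ≤ K₀ := fun y ↦ (hK' y).trans (le_max_left _ _)
  -- the constants of the two equations
  obtain ⟨C₁', hC₁'⟩ := hS13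
  set C₁ : ℝ := max C₁' 0 with hC₁def
  have hC₁0 : 0 ≤ C₁ := le_max_right _ _
  set C₅ : ℝ := 16 * 4 ^ 6 + 4 * 4 ^ 7 with hC₅def
  have hC₅0 : 0 ≤ C₅ := by rw [hC₅def]; norm_num
  -- properness of `f`
  have hK : ∀ c : ℝ, IsCompact {y : M | f y ≤ c} :=
    Shrinker.isCompact_potential_le g hg hc hf hsol hnorm hR0
  -- the function `w = √(|∇Rm|²+1) + |Rm|²`
  set Q : M → ℝ := fun y ↦ g.curvNormSqWith g.leviCivita y with hQdef
  have hQ : ContMDiff (𝓡 4) 𝓘(ℝ, ℝ) ∞ Q := contMDiff_curvNormSqWith g hg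
  set P : M → ℝ := curvDerivNormSq (𝓡 4) (fun _ ↦ g) 1 0 with hPdef
  have hP : ContMDiff (𝓡 4) 𝓘(ℝ, ℝ) ∞ P := fun z ↦
    contMDiffAt_curvDerivNormSq (g := fun _ ↦ g) (t := 0) hg 1 z
  have hP0 : ∀ y, 0 ≤ P y := fun y ↦ curvDerivNormSq_nonneg (g := fun _ ↦ g) (t := 0) hg 1 y
  set w : M → ℝ := fun y ↦ (P y + 1) ^ ((1 / 2 : ℝ)) + Q y with hwdef
  have hw : ContMDiff (𝓡 4) 𝓘(ℝ, ℝ) ∞ w := by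
    intro y
    have hpos : P y + 1 ≠ 0 := by linarith [hP0 y]
    have hφ : ContDiffAt ℝ ∞ (fun s : ℝ ↦ (s + 1) ^ ((1 / 2 : ℝ))) (P y) :=
      (contDiffAt_id.add contDiffAt_const).rpow_const_of_ne hpos
    exact (hφ.contMDiffAt.comp y (hP y)).add (hQ y)
  set K : ℝ := 2 + 2 * K₀ ^ 2 + C₅ * (Real.sqrt K₀ + 1) * K₀ + C₁ ^ 2 * (Real.sqrt K₀ + 1) ^ 2
    with hKdef
  -- ### the drift inequality at every point, through the chart at the point
  have hdrift : ∀ x : M, (0 : ℝ) ≤ f x → 1 / 2 * w x ^ 2 - K ≤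
      g.dalembertian w x - g.innerDual x (mvfderiv (𝓡 4) f x).toLinearMap
        (mvfderiv (𝓡 4) w x).toLinearMap := by
    intro x _
    -- chart data at `x`
    set G := chartRep (𝓡 4) (fun _ ↦ g) x 0 with hGdef
    set bE := finBasis ℝ (EuclideanSpace ℝ (Fin 4)) with hbEdef
    have hGm : MetricCoord.IsMetricOn G (extChartAt (𝓡 4) x).target :=
      Lorentzian.OpensChart.isMetricOn_repr (val_chartPullback_eq_chartRep (fun _ : ℝ ↦ g) x 0)
    have hposT : ∀ y ∈ (extChartAt (𝓡 4) x).target, ∀ w : EuclideanSpace ℝ (Fin 4), w ≠ 0 → 0 < G y w w := by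
      intro y hy w hw
      rw [show y = ((⟨y, hy⟩ : chartTarget (𝓡 4) x) : EuclideanSpace ℝ (Fin 4)) from rfl, hGdef,
        chartRep_apply]
      exact chartPullback_pos g x ⟨y, hy⟩ (fun w' hw' ↦ hg _ w' hw') w hw
    set fh : EuclideanSpace ℝ (Fin 4) → ℝ := f ∘ (extChartAt (𝓡 4) x).symm with hfhdef
    have hfh : ContDiffOn ℝ ∞ fh (extChartAt (𝓡 4) x).target := by
      rw [hfhdef, ← contMDiffOn_iff_contDiffOn]
      exact hf.comp_contMDiffOn (contMDiffOn_extChartAt_symm x)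
    have hsolc : ∀ y ∈ (extChartAt (𝓡 4) x).target, ∀ v w : EuclideanSpace ℝ (Fin 4),
        MetricCoord.ricAt G y v w + MetricCoord.hessAt G fh y v w = (1 / 2 : ℝ) * G y v w :=
      soliton_chartRep_target g x hf hsol
    have hu0 : extChartAt (𝓡 4) x x ∈ (extChartAt (𝓡 4) x).target := mem_extChartAt_target x
    set U₀ : chartTarget (𝓡 4) x := ⟨extChartAt (𝓡 4) x x, hu0⟩ with hU₀def
    have hΦ : chartInv (𝓡 4) x U₀ = x := extChartAt_to_inv x
    have h4 : finrank ℝ (EuclideanSpace ℝ (Fin 4)) = 4 := finrank_euclideanSpace_fin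
    obtain ⟨e, he⟩ := MetricCoord.exists_orthonormal_basis (hGm.symm _ hu0) (hposT _ hu0)
    set eo : Basis (Fin 4) ℝ (EuclideanSpace ℝ (Fin 4)) := e.reindex (finCongr h4) with heodef
    have heo : ∀ i j, G (U₀ : EuclideanSpace ℝ (Fin 4)) (eo i) (eo j) = if i = j then 1 else 0 := by
      intro i j
      rw [heodef, Basis.reindex_apply, Basis.reindex_apply, he]
      by_cases hij : i = j
      · subst hij; simp
      · simp [hij]
    -- the inputs at `U₀`
    have h13 := hC₁' G _ (U₀ : EuclideanSpace ℝ (Fin 4)) fh bE hGm hu0 h4 (hposT _ hu0) hfh hsolc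
    obtain ⟨hbr, -⟩ := hS13b G _ (U₀ : EuclideanSpace ℝ (Fin 4)) bE eo hGm hu0 h4 heo
    have hRm : 2 * MetricCoord.tnormSq G bE (MetricCoord.tcov G bE (MetricCoord.rm4 G bE)) (U₀ : EuclideanSpace ℝ (Fin 4))
        - C₅ * (Real.sqrt (MetricCoord.rmNormSqAt G (U₀ : EuclideanSpace ℝ (Fin 4))) + 1) *
          MetricCoord.rmNormSqAt G (U₀ : EuclideanSpace ℝ (Fin 4)) ≤
        MetricCoord.lapAt G (MetricCoord.rmNormSqAt G) (U₀ : EuclideanSpace ℝ (Fin 4))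
          - fderiv ℝ (MetricCoord.rmNormSqAt G) (U₀ : EuclideanSpace ℝ (Fin 4))
              (MetricCoord.sharpAt G (U₀ : EuclideanSpace ℝ (Fin 4)) (fderiv ℝ fh (U₀ : EuclideanSpace ℝ (Fin 4)))) := by
      have h := hGm.lapAt_rmNormSqAt_sub_fderiv_ge_of_soliton eo heo hu0 hfh hsolc
      have hn : (Fintype.card (Fin 4) : ℝ) = 4 := by simp
      rw [hn, ← hbr] at h
      have hM0 : 0 ≤ MetricCoord.rmNormSqAt G (U₀ : EuclideanSpace ℝ (Fin 4)) :=
        hGm.rmNormSqAt_nonneg eo heo hu0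
      have hs0 : 0 ≤ Real.sqrt (MetricCoord.rmNormSqAt G (U₀ : EuclideanSpace ℝ (Fin 4))) := Real.sqrt_nonneg _
      have hC5 : (16 : ℝ) * 4 ^ 6 + 4 * 4 ^ 7 = C₅ := rfl
      nlinarith [h, hM0, hs0, mul_nonneg hM0 hs0]
    -- the weaker form of `h13` with the constant `C₁ ≥ C₁'`
    have h13' : 2 * MetricCoord.tnormSq G bE (MetricCoord.tcov G bE (MetricCoord.tcov G bE (MetricCoord.rm4 G bE))) (U₀ : EuclideanSpace ℝ (Fin 4))
        + 3 * MetricCoord.tnormSq G bE (MetricCoord.tcov G bE (MetricCoord.rm4 G bE)) (U₀ : EuclideanSpace ℝ (Fin 4))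
        - C₁ * (Real.sqrt (MetricCoord.rmNormSqAt G (U₀ : EuclideanSpace ℝ (Fin 4))) + 1) *
          MetricCoord.tnormSq G bE (MetricCoord.tcov G bE (MetricCoord.rm4 G bE)) (U₀ : EuclideanSpace ℝ (Fin 4)) ≤
        MetricCoord.lapAt G (MetricCoord.tnormSq G bE (MetricCoord.tcov G bE (MetricCoord.rm4 G bE))) (U₀ : EuclideanSpace ℝ (Fin 4))
          - fderiv ℝ (MetricCoord.tnormSq G bE (MetricCoord.tcov G bE (MetricCoord.rm4 G bE))) (U₀ : EuclideanSpace ℝ (Fin 4))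
              (MetricCoord.sharpAt G (U₀ : EuclideanSpace ℝ (Fin 4)) (fderiv ℝ fh (U₀ : EuclideanSpace ℝ (Fin 4)))) ∧
        MetricCoord.gradSqAt G (MetricCoord.tnormSq G bE (MetricCoord.tcov G bE (MetricCoord.rm4 G bE))) (U₀ : EuclideanSpace ℝ (Fin 4)) ≤
          4 * MetricCoord.tnormSq G bE (MetricCoord.tcov G bE (MetricCoord.rm4 G bE)) (U₀ : EuclideanSpace ℝ (Fin 4)) *
            MetricCoord.tnormSq G bE (MetricCoord.tcov G bE (MetricCoord.tcov G bE (MetricCoord.rm4 G bE))) (U₀ : EuclideanSpace ℝ (Fin 4)) ∧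
        0 ≤ MetricCoord.tnormSq G bE (MetricCoord.tcov G bE (MetricCoord.rm4 G bE)) (U₀ : EuclideanSpace ℝ (Fin 4)) ∧
        0 ≤ MetricCoord.tnormSq G bE (MetricCoord.tcov G bE (MetricCoord.tcov G bE (MetricCoord.rm4 G bE))) (U₀ : EuclideanSpace ℝ (Fin 4)) := by
      obtain ⟨h1, h2, h3, h4'⟩ := h13
      refine ⟨le_trans ?_ h1, h2, h3, h4'⟩
      have hle : C₁' ≤ C₁ := le_max_left _ _
      have hs0 : 0 ≤ (Real.sqrt (MetricCoord.rmNormSqAt G (U₀ : EuclideanSpace ℝ (Fin 4))) + 1) *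
          MetricCoord.tnormSq G bE (MetricCoord.tcov G bE (MetricCoord.rm4 G bE)) (U₀ : EuclideanSpace ℝ (Fin 4)) :=
        by positivity
      nlinarith [mul_le_mul_of_nonneg_right hle hs0]
    -- `|Rm|² ≤ K₀` read in the chart
    have hQx : g.curvNormSqWith g.leviCivita x = MetricCoord.rmNormSqAt G (extChartAt (𝓡 4) x x) := by
      have h := curvNormSqWith_chartInv_eq g x U₀
      rwa [hΦ] at h
    have key := hS14 G _ (U₀ : EuclideanSpace ℝ (Fin 4)) fh bE C₁ C₅ K₀ hGm hu0 (hposT _ hu0) hfh hsolc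
      hC₁0 hC₅0 hK₀0 (by rw [← hQx]; exact hK₀ x) hRm h13'
    -- ### transport back to the manifold
    have hwrep : (w ∘ (extChartAt (𝓡 4) x).symm) =ᶠ[𝓝 (U₀ : EuclideanSpace ℝ (Fin 4))]
        fun y ↦ (MetricCoord.tnormSq G bE (MetricCoord.tcov G bE (MetricCoord.rm4 G bE)) y + 1) ^ ((1 / 2 : ℝ))
          + MetricCoord.rmNormSqAt G y := by
      filter_upwards [(isOpen_extChartAt_target x).mem_nhds hu0] with z hz
      have hzs : (extChartAt (𝓡 4) x).symm z ∈ (extChartAt (𝓡 4) x).source :=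
        (extChartAt (𝓡 4) x).map_target hz
      have h1 := curvDerivNormSq_one_eq_chart g hg x hzs
      rw [(extChartAt (𝓡 4) x).right_inv hz] at h1
      have h2 := curvNormSqWith_chartInv_eq g x ⟨z, hz⟩
      simp only [Function.comp_apply, hwdef, hQdef, hPdef]
      rw [h1, ← h2]
      rfl
    have hw2 : ContMDiffAt (𝓡 4) 𝓘(ℝ, ℝ) 2 w (chartInv (𝓡 4) x U₀) :=
      ((hw.of_le (WithTop.coe_le_coe.mpr le_top)).contMDiffAt)
    have hwd : MDifferentiableAt (𝓡 4) 𝓘(ℝ, ℝ) w (chartInv (𝓡 4) x U₀) :=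
      hw.mdifferentiableAt (by simp)
    have hfd : MDifferentiableAt (𝓡 4) 𝓘(ℝ, ℝ) f (chartInv (𝓡 4) x U₀) := hf.mdifferentiableAt (by simp)
    have hlap : g.dalembertian w x = MetricCoord.lapAt G
        (fun y ↦ (MetricCoord.tnormSq G bE (MetricCoord.tcov G bE (MetricCoord.rm4 G bE)) y + 1) ^ ((1 / 2 : ℝ))
          + MetricCoord.rmNormSqAt G y) (extChartAt (𝓡 4) x x) := by
      have h := dalembertian_chartInv_eq g x U₀ hw2
      rw [hΦ] at h
      rw [h]
      exact MetricCoord.lapAt_congr_of_eventuallyEq G hwrep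
    have hi := hGm.isInvertible _ hu0
    have hsG := hGm.symm _ hu0
    have hI : g.innerDual x (mvfderiv (𝓡 4) f x).toLinearMap (mvfderiv (𝓡 4) w x).toLinearMap =
        fderiv ℝ (fun y ↦ (MetricCoord.tnormSq G bE (MetricCoord.tcov G bE (MetricCoord.rm4 G bE)) y + 1) ^ ((1 / 2 : ℝ))
          + MetricCoord.rmNormSqAt G y) (extChartAt (𝓡 4) x x)
            (MetricCoord.sharpAt G (extChartAt (𝓡 4) x x) (fderiv ℝ fh (extChartAt (𝓡 4) x x))) := by
      have h := innerDual_chartInv_eq g x U₀ hfd hwd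
      rw [hΦ] at h
      change g.innerDual x (mvfderiv (𝓡 4) f x).toLinearMap (mvfderiv (𝓡 4) w x).toLinearMap = _ at h
      rw [h, hwrep.fderiv_eq, ← hfhdef]
      set φw := fderiv ℝ (fun y ↦ (MetricCoord.tnormSq G bE (MetricCoord.tcov G bE (MetricCoord.rm4 G bE)) y + 1) ^ ((1 / 2 : ℝ))
          + MetricCoord.rmNormSqAt G y) (extChartAt (𝓡 4) x x)
      rw [← MetricCoord.apply_sharpAt_apply hi φw (MetricCoord.sharpAt G _ (fderiv ℝ fh _)), hsG,
        MetricCoord.apply_sharpAt_apply hi]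
    have hwx : w x = (MetricCoord.tnormSq G bE (MetricCoord.tcov G bE (MetricCoord.rm4 G bE)) (extChartAt (𝓡 4) x x) + 1) ^ ((1 / 2 : ℝ))
        + MetricCoord.rmNormSqAt G (extChartAt (𝓡 4) x x) := by
      have h := hwrep.self_of_nhds
      simp only [Function.comp_apply] at h
      rw [← h]
      congr 1
      exact hΦ.symm
    rw [hlap, hI, hwx, hKdef]
    exact key
  -- ### the maximum principle (threshold `r₀ = 0`)
  obtain ⟨C, hC⟩ := hS9 4 M g f w hg (1 / 2) K 0 (by norm_num) hK hf hw hsol hnorm hR0 hdrift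
  refine ⟨C ^ 2, fun x ↦ ?_⟩
  have hPx : 0 ≤ P x := hP0 x
  have hQ0 : 0 ≤ Q x := curvNormSqWith_nonneg hg (PseudoRiemannianMetric.isLeviCivita_leviCivita_holds (g := g)) x
  have hρ : (P x + 1) ^ ((1 / 2 : ℝ)) = Real.sqrt (P x + 1) := by rw [Real.sqrt_eq_rpow]
  have h1 : Real.sqrt (P x + 1) ≤ C := by
    have h := hC x
    simp only [hwdef, hρ] at h
    linarith
  have h2 : P x + 1 ≤ C ^ 2 := by
    have h3 : 0 ≤ Real.sqrt (P x + 1) := Real.sqrt_nonneg _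
    have h4 := Real.sq_sqrt (by linarith : 0 ≤ P x + 1)
    nlinarith [mul_le_mul h1 h1 h3 (h3.trans h1)]
  show curvDerivNormSq (𝓡 4) (fun _ ↦ g) 1 0 x ≤ C ^ 2
  have : P x = curvDerivNormSq (𝓡 4) (fun _ ↦ g) 1 0 x := rfl
  linarith

end FourShrinker

end Literature.Geometry.Riemannian

end
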